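import Summits.BirchSwinnertonDyer.BirchSwinnertonDyer.Theorems.ResidualThetaTransportAtTwoResidualSignedLambdaLowerCMAtTwoPlaceCutGlue
import HarnessLib

/-!
# stub-ideation k1 · gen 17 — `stub_cmLambdaLower` (RSL_g, stmt-22608) · weaken / strengthen ledger of the PLACE CUT

Crux `ResidualThetaCountLowerPureAtTwo` (stmt-BirchSwinnertonDyer-26074), skeleton `Lines/bt26_lambda.lean` v6, stub
`stub_cmLambdaLower : …Theses.ResidualThetaTransportAtTwo.ResidualSignedLambdaLowerCMAtTwo` BY NAME (never re-typed here).
BSD is NOT proved by any of this; RSL_g and 26074 stay OPEN; nothing is closed, claimed or proposed to `Theorems/`.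

On the carriers of the landed place-cut glue `Theorems.PlaceCutGlue` (p-landed, tp2-p2x-w2 g17) — `c₂, cS, loc₂, locS, ld₂, ldS`,
test space `SelRel` — this file records, kernel-checked, the four corners {weak `∃ a ≠ 0`, exact `a = 1`} × {cut ⟹ `hDHrel`,
`hDHrel` ⟹ cut}:

* §1 `exists_character_extending` — a character of `SelRel` that kills `ker loc₂` is `ψ ∘ loc₂` for a character `ψ` of ALL of
  `D₂` (descend to `range loc₂`, extend by injectivity of `ℚ/ℤ`: `CharacterModule.dual_surjective_of_injective`).
* §2 `away_of_hDHrel` — the AWAY-SIDE CONVERSE of the place cut: `hDHrel` + `c₂` onto (PERF₂) ⟹ S4₀ exactly as the LEAD's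
  `text_S40.sig` types it (orthogonality against the STRICT-at-2 classes only, no side condition). Twin of the landed
  `PlaceCutGlue.atTwo_of_hDHrel` (which needs no surjectivity).
* §3 `hDHrel_iff_placeCut` — given EH and (PERF₂) the place cut is an EQUIVALENCE `hDHrel ↔ S4₂ ∧ S4₀`: the two split texts
  are jointly the WEAKEST sufficient AND necessary form; neither is over-strong; a refutation of either child (under EH, PERF₂)
  refutes the parent's `hDHrel` binder.
* §4 the exact (`a = 1`) corner: `hDHrel_exact_of_placeCut_exact` (no `NoZeroDivisors`, no scaling), its two converses, and
  the one-liners exact ⟹ weak. The strongest provable forms (Poitou–Tate exactness in the limit) imply the weak ones the entry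
  `LambdaLowerBoundO.cmLambdaLower_of_intDualityData` consumes; nothing in the count needs `a = 1`.

[cite: GreenbergVatsal2000, §2 Prop. 2.1, Cor. 2.3] [cite: MilneADT2006, Ch. I, Thm. 4.10] [cite: Kobayashi2003, Thm. 7.3]
-/

namespace Summit.BirchSwinnertonDyer.BirchSwinnertonDyer.Cruxes.ResidualThetaCountLowerPureAtTwo.SideaK1G17

open Summit.BirchSwinnertonDyer.BirchSwinnertonDyer.Theorems

universe u v

variable {A : Type u} [CommRing A]
  {P₀ : Type v} [AddCommGroup P₀] [Module A P₀]
  {PS : Type v} [AddCommGroup PS] [Module A PS]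
  {D₂ : Type v} [AddCommGroup D₂] [Module A D₂]
  {DS : Type v} [AddCommGroup DS] [Module A DS]
  {H : Type v} [AddCommGroup H] [Module A H]
  {SelRel : Type v} [AddCommGroup SelRel] [Module A SelRel]

/-! ## §1 Character extension through `loc₂` -/

/-- A character `ψ₀` of the test space that vanishes on `ker loc₂` is the pull-back along `loc₂` of a character of the whole
local group `D₂` (descend to `range loc₂` by `AddMonoidHom.liftOfSurjective`, extend by the injectivity of `ℚ/ℤ`,
`CharacterModule.dual_surjective_of_injective`). [cite: MilneADT2006, Ch. I, §0 (0.19) and Thm. 4.10] -/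
theorem exists_character_extending (loc₂ : SelRel →ₗ[A] D₂) (ψ₀ : SelRel →+ AddCircle (1 : ℚ))
    (hψ : ∀ s : SelRel, loc₂ s = 0 → ψ₀ s = 0) :
    ∃ ψ : CharacterModule D₂, ∀ s : SelRel, ψ (loc₂ s) = ψ₀ s := by
  classical
  -- descend ψ₀ to the range of loc₂
  let f : SelRel →+ ↥(loc₂.toAddMonoidHom.range) := loc₂.toAddMonoidHom.rangeRestrict
  have hfs : Function.Surjective f := AddMonoidHom.rangeRestrict_surjective _
  have hfval : ∀ s : SelRel, ((f s : ↥(loc₂.toAddMonoidHom.range)) : D₂) = loc₂ s := fun s => rfl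
  have hker : f.ker ≤ ψ₀.ker := by
    intro s hs
    rw [AddMonoidHom.mem_ker] at hs ⊢
    apply hψ
    rw [← hfval s, hs]
    rfl
  let ψ₁ : ↥(loc₂.toAddMonoidHom.range) →+ AddCircle (1 : ℚ) := f.liftOfSurjective hfs ⟨ψ₀, hker⟩
  have hψ₁ : ∀ s : SelRel, ψ₁ (f s) = ψ₀ s := fun s =>
    f.liftOfRightInverse_comp_apply (Function.surjInv hfs) (Function.rightInverse_surjInv hfs) ⟨ψ₀, hker⟩ s
  -- extend from the range to all of D₂
  let ι : ↥(loc₂.toAddMonoidHom.range) →ₗ[ℤ] D₂ := (AddSubgroup.subtype _).toIntLinearMap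
  have hι : Function.Injective ι := fun a b h => Subtype.ext h
  obtain ⟨ψ, hψext⟩ := CharacterModule.dual_surjective_of_injective ι hι ψ₁
  refine ⟨ψ, fun s => ?_⟩
  have h1 : (CharacterModule.dual ι ψ) (f s) = ψ₁ (f s) := DFunLike.congr_fun hψext (f s)
  rw [← hψ₁ s, ← h1]
  rfl

/-! ## §2 The away-side converse of the place cut (needs `c₂` onto = (PERF₂)) -/

/-- **`hDHrel` ∧ (PERF₂: `c₂` onto) ⟹ S4₀** in exactly the drafted shape (`text_S40.sig`): a character `χ` of the S₀-side
orthogonal to the classes that are STRICT at `2` is, up to `a ≠ 0`, an `ldS`-value — with no condition on `ld₂`. Proof: the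
character `s ↦ −cS χ (locS s)` kills `ker loc₂`, so (§1) it is `ψ ∘ loc₂`; pick `z` with `c₂ z = ψ`; then `(z, χ) ⊥ SelRel` and
`hDHrel` applies. Twin of `PlaceCutGlue.atTwo_of_hDHrel`. [cite: GreenbergVatsal2000, §2 Prop. 2.1, Cor. 2.3]
[cite: MilneADT2006, Ch. I, Thm. 4.10 (b)] -/
theorem away_of_hDHrel
    (c₂ : P₀ →ₗ[A] CharacterModule D₂) (cS : PS →ₗ[A] CharacterModule DS)
    (loc₂ : SelRel →ₗ[A] D₂) (locS : SelRel →ₗ[A] DS)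
    (ld₂ : H →ₗ[A] P₀) (ldS : H →ₗ[A] PS)
    (hc₂ : Function.Surjective c₂)
    (hDHrel : ∀ t : P₀ × PS, (∀ s : SelRel, c₂ t.1 (loc₂ s) + cS t.2 (locS s) = 0) →
      ∃ a : A, a ≠ 0 ∧ ∃ x : H, a • t = (ld₂.prod ldS) x) :
    ∀ χ : PS, (∀ s : SelRel, loc₂ s = 0 → cS χ (locS s) = 0) →
      ∃ a : A, a ≠ 0 ∧ ∃ x : H, a • χ = ldS x := by
  intro χ hχ
  let ψ₀ : SelRel →+ AddCircle (1 : ℚ) := -((cS χ).comp locS.toAddMonoidHom)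
  have hψ₀ : ∀ s : SelRel, ψ₀ s = -(cS χ (locS s)) := fun s => rfl
  obtain ⟨ψ, hψ⟩ := exists_character_extending loc₂ ψ₀ (fun s hs => by
    rw [hψ₀, hχ s hs, neg_zero])
  obtain ⟨z, hz⟩ := hc₂ ψ
  obtain ⟨a, ha, x, hx⟩ := hDHrel (z, χ) (fun s => by
    show c₂ z (loc₂ s) + cS χ (locS s) = 0
    rw [hz, hψ s, hψ₀, neg_add_cancel])
  exact ⟨a, ha, x, by simpa using congrArg Prod.snd hx⟩

/-! ## §3 The place cut is an equivalence -/

/-- **Given EH and (PERF₂), `hDHrel ↔ S4₂ ∧ S4₀`.** `→`: `PlaceCutGlue.atTwo_of_hDHrel` and §2; `←`: the landed place cut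
`PlaceCutGlue.hDHrel_of_placeCut`. So the drafted split texts are, jointly, the weakest sufficient AND a necessary form of the
entry's relaxed deep half: the cut loses nothing. [cite: Kobayashi2003, Thm. 7.3 ((7.17)–(7.21))] [cite: MilneADT2006, Ch. I, Thm. 4.10 (b)] -/
theorem hDHrel_iff_placeCut [NoZeroDivisors A]
    (c₂ : P₀ →ₗ[A] CharacterModule D₂) (cS : PS →ₗ[A] CharacterModule DS)
    (loc₂ : SelRel →ₗ[A] D₂) (locS : SelRel →ₗ[A] DS)
    (ld₂ : H →ₗ[A] P₀) (ldS : H →ₗ[A] PS)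
    (hEH : ∀ (x : H) (s : SelRel), c₂ (ld₂ x) (loc₂ s) + cS (ldS x) (locS s) = 0)
    (hc₂ : Function.Surjective c₂) :
    (∀ t : P₀ × PS, (∀ s : SelRel, c₂ t.1 (loc₂ s) + cS t.2 (locS s) = 0) →
      ∃ a : A, a ≠ 0 ∧ ∃ x : H, a • t = (ld₂.prod ldS) x) ↔
    ((∀ z : P₀, (∀ s : SelRel, c₂ z (loc₂ s) = 0) →
        ∃ a : A, a ≠ 0 ∧ ∃ x : H, ldS x = 0 ∧ a • z = ld₂ x) ∧
     (∀ χ : PS, (∀ s : SelRel, loc₂ s = 0 → cS χ (locS s) = 0) →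
        ∃ a : A, a ≠ 0 ∧ ∃ x : H, a • χ = ldS x)) :=
  ⟨fun h => ⟨PlaceCutGlue.atTwo_of_hDHrel c₂ cS loc₂ locS ld₂ ldS h, away_of_hDHrel c₂ cS loc₂ locS ld₂ ldS hc₂ h⟩,
   fun h => PlaceCutGlue.hDHrel_of_placeCut c₂ cS loc₂ locS ld₂ ldS hEH h.1 h.2⟩

/-! ## §4 The exact (`a = 1`) corner — strongest provable forms, and exact ⟹ weak -/

/-- **Exact place cut**: S4₂ with `a = 1` ∧ S4₀ with `a = 1` ∧ EH ⟹ `hDHrel` with `a = 1` (no `NoZeroDivisors`, no scaling).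
[cite: MilneADT2006, Ch. I, Thm. 4.10 (b)] -/
theorem hDHrel_exact_of_placeCut_exact
    (c₂ : P₀ →ₗ[A] CharacterModule D₂) (cS : PS →ₗ[A] CharacterModule DS)
    (loc₂ : SelRel →ₗ[A] D₂) (locS : SelRel →ₗ[A] DS)
    (ld₂ : H →ₗ[A] P₀) (ldS : H →ₗ[A] PS)
    (hEH : ∀ (x : H) (s : SelRel), c₂ (ld₂ x) (loc₂ s) + cS (ldS x) (locS s) = 0)
    (h2 : ∀ z : P₀, (∀ s : SelRel, c₂ z (loc₂ s) = 0) → ∃ x : H, ldS x = 0 ∧ z = ld₂ x)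
    (h0 : ∀ χ : PS, (∀ s : SelRel, loc₂ s = 0 → cS χ (locS s) = 0) → ∃ x : H, χ = ldS x) :
    ∀ t : P₀ × PS, (∀ s : SelRel, c₂ t.1 (loc₂ s) + cS t.2 (locS s) = 0) →
      ∃ x : H, t = (ld₂.prod ldS) x := by
  rintro ⟨z, χ⟩ ht
  have hχ : ∀ s : SelRel, loc₂ s = 0 → cS χ (locS s) = 0 := by
    intro s hs
    have h := ht s
    rw [hs, map_zero, zero_add] at h
    exact h
  obtain ⟨x₀, hx₀⟩ := h0 χ hχ
  have hz' : ∀ s : SelRel, c₂ (z - ld₂ x₀) (loc₂ s) = 0 := by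
    intro s
    have h1 : c₂ z (loc₂ s) + cS χ (locS s) = 0 := ht s
    have h2 : c₂ (ld₂ x₀) (loc₂ s) + cS (ldS x₀) (locS s) = 0 := hEH x₀ s
    rw [← hx₀] at h2
    have e0 : c₂ (z - ld₂ x₀) (loc₂ s) = c₂ z (loc₂ s) - c₂ (ld₂ x₀) (loc₂ s) := by
      rw [map_sub c₂]
      rfl
    rw [e0, eq_neg_of_add_eq_zero_left h1, eq_neg_of_add_eq_zero_left h2, sub_self]
  obtain ⟨x₁, hx₁S, hx₁⟩ := h2 _ hz'
  refine ⟨x₀ + x₁, Prod.ext ?_ ?_⟩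
  · show z = ld₂ (x₀ + x₁)
    rw [map_add, ← hx₁, add_sub_cancel]
  · show χ = ldS (x₀ + x₁)
    rw [map_add, hx₁S, add_zero, ← hx₀]

/-- Exact `hDHrel` ⟹ exact S4₂ (twin of `PlaceCutGlue.atTwo_of_hDHrel`). [cite: MilneADT2006, Ch. I, Thm. 4.10 (b)] -/
theorem atTwo_exact_of_hDHrel_exact
    (c₂ : P₀ →ₗ[A] CharacterModule D₂) (cS : PS →ₗ[A] CharacterModule DS)
    (loc₂ : SelRel →ₗ[A] D₂) (locS : SelRel →ₗ[A] DS)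
    (ld₂ : H →ₗ[A] P₀) (ldS : H →ₗ[A] PS)
    (hDH : ∀ t : P₀ × PS, (∀ s : SelRel, c₂ t.1 (loc₂ s) + cS t.2 (locS s) = 0) →
      ∃ x : H, t = (ld₂.prod ldS) x) :
    ∀ z : P₀, (∀ s : SelRel, c₂ z (loc₂ s) = 0) → ∃ x : H, ldS x = 0 ∧ z = ld₂ x := by
  intro z hz
  obtain ⟨x, hx⟩ := hDH (z, 0) fun s => by
    show c₂ z (loc₂ s) + cS 0 (locS s) = 0
    rw [hz s, map_zero, zero_add]
    rfl
  exact ⟨x, by simpa using (congrArg Prod.snd hx).symm, by simpa using congrArg Prod.fst hx⟩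

/-- Exact `hDHrel` ∧ (PERF₂) ⟹ exact S4₀ (the away-side converse, `a = 1`). [cite: GreenbergVatsal2000, §2 Cor. 2.3] -/
theorem away_exact_of_hDHrel_exact
    (c₂ : P₀ →ₗ[A] CharacterModule D₂) (cS : PS →ₗ[A] CharacterModule DS)
    (loc₂ : SelRel →ₗ[A] D₂) (locS : SelRel →ₗ[A] DS)
    (ld₂ : H →ₗ[A] P₀) (ldS : H →ₗ[A] PS)
    (hc₂ : Function.Surjective c₂)
    (hDH : ∀ t : P₀ × PS, (∀ s : SelRel, c₂ t.1 (loc₂ s) + cS t.2 (locS s) = 0) →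
      ∃ x : H, t = (ld₂.prod ldS) x) :
    ∀ χ : PS, (∀ s : SelRel, loc₂ s = 0 → cS χ (locS s) = 0) → ∃ x : H, χ = ldS x := by
  intro χ hχ
  let ψ₀ : SelRel →+ AddCircle (1 : ℚ) := -((cS χ).comp locS.toAddMonoidHom)
  have hψ₀ : ∀ s : SelRel, ψ₀ s = -(cS χ (locS s)) := fun s => rfl
  obtain ⟨ψ, hψ⟩ := exists_character_extending loc₂ ψ₀ (fun s hs => by
    rw [hψ₀, hχ s hs, neg_zero])
  obtain ⟨z, hz⟩ := hc₂ ψ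
  obtain ⟨x, hx⟩ := hDH (z, χ) (fun s => by
    show c₂ z (loc₂ s) + cS χ (locS s) = 0
    rw [hz, hψ s, hψ₀, neg_add_cancel])
  exact ⟨x, by simpa using congrArg Prod.snd hx⟩

/-- Exact ⟹ weak for S4₀ (`a := 1`). [cite: GreenbergVatsal2000, §2 Cor. 2.3] -/
theorem away_weak_of_exact [Nontrivial A] (ldS : H →ₗ[A] PS) (K : PS → Prop)
    (h : ∀ χ : PS, K χ → ∃ x : H, χ = ldS x) :
    ∀ χ : PS, K χ → ∃ a : A, a ≠ 0 ∧ ∃ x : H, a • χ = ldS x := fun χ hχ => by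
  obtain ⟨x, hx⟩ := h χ hχ
  exact ⟨1, one_ne_zero, x, by rw [one_smul, hx]⟩

/-- Exact ⟹ weak for S4₂ (`a := 1`). [cite: MilneADT2006, Ch. I, Thm. 4.10 (b)] -/
theorem atTwo_weak_of_exact [Nontrivial A] (ld₂ : H →ₗ[A] P₀) (ldS : H →ₗ[A] PS) (K : P₀ → Prop)
    (h : ∀ z : P₀, K z → ∃ x : H, ldS x = 0 ∧ z = ld₂ x) :
    ∀ z : P₀, K z → ∃ a : A, a ≠ 0 ∧ ∃ x : H, ldS x = 0 ∧ a • z = ld₂ x := fun z hz => by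
  obtain ⟨x, hxS, hx⟩ := h z hz
  exact ⟨1, one_ne_zero, x, hxS, by rw [one_smul, hx]⟩

/-- Exact ⟹ weak for `hDHrel` (`a := 1`): the strongest provable form feeds the entry's binder unchanged.
[cite: MilneADT2006, Ch. I, Thm. 4.10 (b)] -/
theorem hDHrel_weak_of_exact [Nontrivial A] (ld₂ : H →ₗ[A] P₀) (ldS : H →ₗ[A] PS) (K : P₀ × PS → Prop)
    (h : ∀ t : P₀ × PS, K t → ∃ x : H, t = (ld₂.prod ldS) x) :
    ∀ t : P₀ × PS, K t → ∃ a : A, a ≠ 0 ∧ ∃ x : H, a • t = (ld₂.prod ldS) x := fun t ht => by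
  obtain ⟨x, hx⟩ := h t ht
  exact ⟨1, one_ne_zero, x, by rw [one_smul, hx]⟩

end Summit.BirchSwinnertonDyer.BirchSwinnertonDyer.Cruxes.ResidualThetaCountLowerPureAtTwo.SideaK1G17
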